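import Summits.BirchSwinnertonDyer.BirchSwinnertonDyer.Theorems.CumulativeHeegnerLeopoldtRedSplitControlAtThreeShaDualPerfectOfReadout
import Summits.BirchSwinnertonDyer.BirchSwinnertonDyer.Theorems.SchneiderFreeAdditiveX3PoitouTateLocalDualityEveryPlace
import Literature.NumberTheory.GaloisCohomology.PoitouTateSelmerStructuresRealPlaces
import HarnessLib

/-!
# Poitou–Tate at fields WITH REAL PLACES: the annihilator of `Ш¹(K, M^D)` is the image of `γ¹` — archimedean
# components live — and the perfect pairing `Ш²(K, M) × Ш¹(K, M^D) → ℤ/n` from a readout (Milne ADT I Thm. 4.10 (a))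

Crux K4 `SignedControlAtTwo` (stmt-BirchSwinnertonDyer-20309; routes `ThetaPartnerAtTwo` / `ResidualThetaTransportAtTwo`),
line `eulerchar` v12, lead `bsd-wall-tp2-p3` g4 (`--supports stmt-BirchSwinnertonDyer-20309`, helper).  The registered stub
`stub_poitouTateShaRat : poitouTate_sha_tateDual ℚ` is Milne I 4.10 (a) at `K = ℚ` — a field with a REAL place, at `p = 2`.
The consumer-side reduction of that fact in the tree (`PoitouTateShaAnnihilator.exists_family_sum_localTatePairing_eq_of_isTotallyComplex`,
`….sha_tateDual_of_readout`, seat bsd-line-chl-p2 g5) is stated for TOTALLY COMPLEX `K` only: the general-`K` annihilator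
theorem `exists_family_sum_localTatePairing_eq` asks the functional `φ` to kill every class vanishing at the FINITE places
and returns a family `t` that is ZERO at the infinite places.  At a real place `w` and even `n`, `H¹(K_w, M^D) ≠ 0` in
general (`p = 2`!), so `Ш¹(K, M^D)` is smaller than the classes vanishing at the finite places, and the archimedean
components `t_w` of Milne's `P¹(K, M) = ∏' H¹(K_v, M)` (real `v` included, I §4 p. 55) carry information.

This file removes `IsTotallyComplex`, using the tree's archimedean local Tate duality (Milne I Thm. 2.13 (a);
every place: `SchneiderFreeAdditiveX3.PoitouTateReduction.bijective_localTatePairingZMod_place`) for a family injective at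
the real places (`LocalInvariants.InjectiveAtRealPlaces`, Milne I Ex. 1.6 (c); named fact `poitouTate_selmerStructure_duality_real`):
* `exists_archimedean_localTatePairing_correction` — a functional `φ : H¹(K, M^D) → ℤ/n` killing `Ш¹(K, M^D)` agrees, on
  the classes vanishing at all FINITE places, with a sum of ARCHIMEDEAN local Tate pairings `y ↦ ∑_{w ∣ ∞} inv_w (t∞_w ∪ y_w)`
  (lift through the archimedean localisation, extend by the self-injectivity of `ℤ/n`, represent by Thm. 2.13 (a));
* **`exists_family_sum_localTatePairing_eq_real`** — Milne I 4.10, step (b) ⟹ (a), for ANY number field: `IsPerfect`,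
  `InjectiveAtRealPlaces`, `UnramifiedOrthogonal`, `SelmerComplement` ⟹ every additive `φ` vanishing on `Ш¹(K, M^D)` is
  `y ↦ ∑_{v ∈ S} inv_v (t_v ∪ y_v)` for ONE family `t ∈ ∏_v H¹(K_v, M)` unramified off a finite `S₁` (archimedean components
  unrestricted), every `y`, every finite `S ⊇ S₁` off which `y` is unramified — i.e. `Ш¹(K, M^D)^⊥ ⊆ γ¹(P¹(K, M))`;
* `exists_localInvariants_sha_annihilator_of_poitouTate_real` — the same from the named fact
  `poitouTate_selmerStructure_duality_real K` (any `K`; at `K = ℚ` this is what K4 consumes);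
* **`sha_tateDual_of_readout_real`** — for ANY number field, from a readout `e : Ш²(K, M) → Hom(H¹(K, M^D), ℤ/n)` that is
  additive, injective and surjective modulo sums of local pairings (archimedean components live): `Ш²(K, M)` is finite and
  `(c, y) ↦ e(c)(y)` is a PERFECT pairing `Ш²(K, M) × Ш¹(K, M^D) → ℤ/n` — verbatim the existential conclusion of
  `poitouTate_sha_tateDual K` at `(n, M, ρ)`.  NET for K4: `poitouTate_sha_tateDual ℚ` ⟸ {`poitouTate_selmerStructure_duality_real ℚ`,
  the degree-2 readout over `ℚ`} — the same two road-(A) inputs as at totally complex fields, nothing archimedean left over.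

HONEST FRAMING. THEOREMS ONLY (no definition, no named fact, no `sorry`); readout hypotheses and named facts are NOT
discharged here; closes no item; BSD is not proved by any of this.  References: [MilneADT2006] I Thm. 4.10 (a)(b) and proof
(p. 57–58), Thm. 2.13 (a), Ex. 1.6 (c), §4 (p. 55), Prop. 0.19; [Harari2020] Thm. 17.13 (b); [Howard2004HeegnerKolyvagin] 2.1.11; [Lam1999] §15.
-/

noncomputable section

open Function NumberField IsDedekindDomain
open scoped NumberField

universe u

set_option linter.dupNamespace false
set_option autoImplicit false

namespace Summit.BirchSwinnertonDyer.BirchSwinnertonDyer.Theorems.SignedEC.MuReal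

open Literature.NumberTheory.GaloisRepresentations
open Literature.NumberTheory.GaloisRepresentations.DiscreteGaloisModule (mu localTatePairingZMod tateDual
  unramifiedSubgroup sha shaTwo)
open Literature.NumberTheory.GaloisCohomology
open Summit.BirchSwinnertonDyer.BirchSwinnertonDyer.Theorems.PoitouTateShaAnnihilator
  (exists_family_sum_localTatePairing_eq exists_addMonoidHom_extend_of_nsmul_eq_zero)
open Summit.BirchSwinnertonDyer.BirchSwinnertonDyer.Theorems.SchneiderFreeAdditiveX3.PoitouTateReduction
  (bijective_localTatePairingZMod_place pi_nsmul_eq_zero)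

variable {K : Type u} [Field K] [NumberField K] {M : Type u} [AddCommGroup M] [TopologicalSpace M]
  [DiscreteTopology M] [Finite M] {n : ℕ} [NeZero n]

/-! ## §1 The archimedean correction -/

section Archimedean

/-- **Archimedean correction of a functional vanishing on `Ш¹(K, M^D)`.**  For a family `inv` of local invariant
maps perfect at the finite places and injective at the real places, a finite `n`-torsion `M`, and an additive
`φ : H¹(K, M^D) → ℤ/n` vanishing on `Ш¹(K, M^D)` (the classes vanishing at ALL places): there is an archimedean family
`t∞_w ∈ H¹(K_w, M)` (`w ∣ ∞`) with `φ(y) = ∑_{w ∣ ∞} inv_w (t∞_w ∪ y_w)` for every `y` vanishing at all FINITE places.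
(On those classes `φ` factors through `y ↦ (y_w)_{w ∣ ∞} ∈ ∏_w H¹(K_w, M^D)`, its kernel there being `Ш¹`; extend the
factor to the finite `n`-torsion group `∏_w H¹(K_w, M^D)` — `ℤ/n` is self-injective — and represent each coordinate
functional by the archimedean local Tate duality, Milne I Thm. 2.13 (a); complex coordinates vanish.)
[cite: MilneADT2006, Ch. I, Thm. 2.13 (a) (p. 35), Ex. 1.6 (c) (p. 19), Prop. 0.19] [cite: Lam1999, §15] -/
theorem exists_archimedean_localTatePairing_correction {inv : LocalInvariants K n} (hperf : inv.IsPerfect)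
    (hreal : inv.InjectiveAtRealPlaces) (ρ : DiscreteGaloisModule K M) (hM : ∀ m : M, n • m = 0)
    (φ : galoisCohomology (ρ.tateDual n) 1 →+ ZMod n)
    (hφ : ∀ y ∈ sha (ρ.tateDual n), φ y = 0) :
    ∃ tinf : Π w : InfinitePlace K, galoisCohomology (ρ.toLocal (Sum.inl w)) 1,
      ∀ y : galoisCohomology (ρ.tateDual n) 1,
        (∀ v : HeightOneSpectrum (𝓞 K), galoisCohomology.localization (ρ.tateDual n) (Sum.inr v) 1 y = 0) →
        φ y = ∑ w : InfinitePlace K, localTatePairingZMod ρ n (Sum.inl w) (inv (Sum.inl w)) (tinf w)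
          (galoisCohomology.localization (ρ.tateDual n) (Sum.inl w) 1 y) := by
  classical
  -- the classes vanishing at the finite places, and the archimedean localisation on them
  let V : AddSubgroup (galoisCohomology (ρ.tateDual n) 1) :=
    (AddMonoidHom.pi fun v : HeightOneSpectrum (𝓞 K) =>
      galoisCohomology.localization (ρ.tateDual n) (Sum.inr v) 1).ker
  have hV : ∀ y : galoisCohomology (ρ.tateDual n) 1, y ∈ V ↔
      ∀ v : HeightOneSpectrum (𝓞 K), galoisCohomology.localization (ρ.tateDual n) (Sum.inr v) 1 y = 0 := by
    intro y
    rw [AddMonoidHom.mem_ker]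
    exact ⟨fun h v => congr_fun h v, fun h => funext h⟩
  let L : galoisCohomology (ρ.tateDual n) 1 →+
      Π w : InfinitePlace K, galoisCohomology ((ρ.tateDual n).toLocal (Sum.inl w)) 1 :=
    AddMonoidHom.pi fun w : InfinitePlace K => galoisCohomology.localization (ρ.tateDual n) (Sum.inl w) 1
  have hL : ∀ (y : galoisCohomology (ρ.tateDual n) 1) (w : InfinitePlace K),
      L y w = galoisCohomology.localization (ρ.tateDual n) (Sum.inl w) 1 y := fun _ _ => rfl
  let LV : V →+ Π w : InfinitePlace K, galoisCohomology ((ρ.tateDual n).toLocal (Sum.inl w)) 1 :=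
    L.comp V.subtype
  let f : V →+ LV.range := LV.rangeRestrict
  have hf : Surjective f := LV.rangeRestrict_surjective
  -- `φ|_V` kills `Ker (V → ∏_w H¹(K_w, M^D)) = Ш¹(K, M^D)`
  have hker : f.ker ≤ (φ.comp V.subtype).ker := by
    intro y hy
    rw [AddMonoidHom.mem_ker] at hy ⊢
    have hy0 : LV y = 0 := by
      have := congrArg Subtype.val hy
      simpa [f] using this
    rw [AddMonoidHom.comp_apply]
    refine hφ _ ((DiscreteGaloisModule.mem_sha_iff _ _).2 fun v => ?_)
    cases v with
    | inl w =>
      have := congr_fun hy0 w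
      simpa [LV, hL] using this
    | inr v => exact (hV _).1 y.2 v
  -- the factor `χ` on the image, extended to `Φ` on the whole finite product
  let χ : LV.range →+ ZMod n := f.liftOfSurjective hf ⟨φ.comp V.subtype, hker⟩
  have hχ : ∀ y : V, χ (f y) = φ y := fun y =>
    f.liftOfRightInverse_comp_apply (surjInv hf) (rightInverse_surjInv hf) ⟨φ.comp V.subtype, hker⟩ y
  haveI : Finite (DiscreteGaloisModule.TateDual K M n) := DiscreteGaloisModule.TateDual.finite K M n
  have hPiN : ∀ p : Π w : InfinitePlace K, galoisCohomology ((ρ.tateDual n).toLocal (Sum.inl w)) 1, n • p = 0 :=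
    pi_nsmul_eq_zero fun w x => galoisCohomology.nsmul_eq_zero_of_forall _
      (fun g => DiscreteGaloisModule.TateDual.nsmul_eq_zero g) x
  obtain ⟨Φ, hΦ⟩ := exists_addMonoidHom_extend_of_nsmul_eq_zero hPiN LV.range χ
  -- coordinatewise representation by the archimedean local Tate duality
  have hrep : ∀ w : InfinitePlace K, ∃ t : galoisCohomology (ρ.toLocal (Sum.inl w)) 1,
      localTatePairingZMod ρ n (Sum.inl w) (inv (Sum.inl w)) t =
        Φ.comp (AddMonoidHom.single (fun w : InfinitePlace K =>
          galoisCohomology ((ρ.tateDual n).toLocal (Sum.inl w)) 1) w) :=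
    fun w => (bijective_localTatePairingZMod_place inv hperf hreal ρ hM (Sum.inl w)).1.2 _
  choose tinf htinf using hrep
  refine ⟨tinf, fun y hy => ?_⟩
  have hyV : y ∈ V := (hV y).2 hy
  have h1 : φ y = Φ (L y) := by
    have h := hχ ⟨y, hyV⟩
    rw [← hΦ] at h
    rw [← h]
    rfl
  rw [h1, ← Finset.univ_sum_single (L y), map_sum]
  refine Finset.sum_congr rfl fun w _ => ?_
  rw [htinf w, AddMonoidHom.comp_apply, AddMonoidHom.single_apply, hL]

end Archimedean

/-! ## §2 The annihilator of `Ш¹(K, M^D)` is the image of `γ¹`, archimedean components live -/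

section Main

/-- **The annihilator of `Ш¹(K, M^D)` consists of sums of local Tate pairings — ANY number field, real places
included** (Milne I Thm. 4.10: the step (b) ⟹ (a), `Ш¹(K, M^D)^⊥ ⊆ γ¹(P¹(K, M))` with Milne's `P¹ ∋` the real
places).  Let `inv` be a family of local invariant maps with `IsPerfect` (finite places), `InjectiveAtRealPlaces`
(Milne I Ex. 1.6 (c)), `UnramifiedOrthogonal` (Thm. 2.6) and `SelmerComplement` (Howard Thm. 2.1.11); `M` a finite
discrete `Γ_K`-module killed by `n ≥ 1`, unramified outside the finite `S₀ ⊇ {v ∣ ∞} ∪ {v ∣ n}`; and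
`φ : H¹(K, M^D) →+ ℤ/n` additive, vanishing on `Ш¹(K, M^D)`.  Then there are a finite `S₁ ⊇ S₀` and ONE family
`t_v ∈ H¹(K_v, M)` (`v` over ALL places, archimedean components unrestricted), unramified at the finite places
outside `S₁`, with `φ(y) = ∑_{v ∈ S} inv_v (t_v ∪ loc_v y)` for every `y ∈ H¹(K, M^D)` and every finite `S ⊇ S₁`
off which `y` is unramified.  (Proof: subtract the archimedean correction of §1; the difference kills every class
vanishing at the finite places, so the tree's finite-place theorem `exists_family_sum_localTatePairing_eq` applies.)
[cite: MilneADT2006, Ch. I, Thm. 4.10 (a)(b) and proof (p. 57–58), §4 (p. 55), Thm. 2.13 (a), Ex. 1.6 (c)]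
[cite: Howard2004HeegnerKolyvagin, Thm. 2.1.11 (arXiv:1202.6340 p. 6)] -/
theorem exists_family_sum_localTatePairing_eq_real {inv : LocalInvariants K n} (hperf : inv.IsPerfect)
    (hreal : inv.InjectiveAtRealPlaces) (hur : inv.UnramifiedOrthogonal) (hcomp : inv.SelmerComplement)
    (ρ : DiscreteGaloisModule K M) (hM : ∀ m : M, n • m = 0)
    (S₀ : Finset (Place K)) (hinf : ∀ w : InfinitePlace K, (Sum.inl w : Place K) ∈ S₀)
    (hS₀ : ∀ v : HeightOneSpectrum (𝓞 K), (Sum.inr v : Place K) ∉ S₀ →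
      ((n : ℕ) : 𝓞 K) ∉ v.asIdeal ∧ GaloisRep.IsUnramifiedAt v ρ)
    (φ : galoisCohomology (ρ.tateDual n) 1 →+ ZMod n)
    (hφ : ∀ y ∈ sha (ρ.tateDual n), φ y = 0) :
    ∃ (S₁ : Finset (Place K)) (t : Π v : Place K, galoisCohomology (ρ.toLocal v) 1),
      S₀ ⊆ S₁ ∧
      (∀ v : HeightOneSpectrum (𝓞 K), (Sum.inr v : Place K) ∉ S₁ →
        t (Sum.inr v) ∈ unramifiedSubgroup (GaloisRep.toLocal v ρ) 1) ∧
      ∀ (y : galoisCohomology (ρ.tateDual n) 1) (S : Finset (Place K)), S₁ ⊆ S →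
        (∀ v : HeightOneSpectrum (𝓞 K), (Sum.inr v : Place K) ∉ S →
          galoisCohomology.localization (ρ.tateDual n) (Sum.inr v) 1 y ∈
            unramifiedSubgroup (GaloisRep.toLocal v (ρ.tateDual n)) 1) →
        φ y = ∑ v ∈ S, localTatePairingZMod ρ n v (inv v) (t v)
          (galoisCohomology.localization (ρ.tateDual n) v 1 y) := by
  classical
  obtain ⟨tinf, htinf⟩ := exists_archimedean_localTatePairing_correction hperf hreal ρ hM φ hφ
  -- the corrected functional kills every class vanishing at the finite places
  let arch : galoisCohomology (ρ.tateDual n) 1 →+ ZMod n :=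
    ∑ w : InfinitePlace K, (localTatePairingZMod ρ n (Sum.inl w) (inv (Sum.inl w)) (tinf w)).comp
      (galoisCohomology.localization (ρ.tateDual n) (Sum.inl w) 1)
  have harch : ∀ y, arch y = ∑ w : InfinitePlace K, localTatePairingZMod ρ n (Sum.inl w) (inv (Sum.inl w))
      (tinf w) (galoisCohomology.localization (ρ.tateDual n) (Sum.inl w) 1 y) := fun y => by
    simp only [arch, AddMonoidHom.finsetSum_apply, AddMonoidHom.comp_apply]
  obtain ⟨S₁, t₀, hS₀S₁, ht₀inl, ht₀ur, hformula⟩ :=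
    exists_family_sum_localTatePairing_eq hperf hur hcomp ρ hM S₀ hinf hS₀ (φ - arch) fun y hy => by
      rw [AddMonoidHom.sub_apply, harch, htinf y hy, sub_self]
  -- splice the archimedean family into `t₀`
  let t : Π v : Place K, galoisCohomology (ρ.toLocal v) 1 := fun v =>
    match v with
    | Sum.inl w => tinf w
    | Sum.inr v' => t₀ (Sum.inr v')
  refine ⟨S₁, t, hS₀S₁, fun v hv => ht₀ur v hv, fun y S hS₁S hy => ?_⟩
  have hmain := hformula y S hS₁S hy
  rw [AddMonoidHom.sub_apply, sub_eq_iff_eq_add, harch] at hmain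
  rw [hmain]
  let h : Place K → ZMod n := fun v =>
    match v with
    | Sum.inl w => localTatePairingZMod ρ n (Sum.inl w) (inv (Sum.inl w)) (tinf w)
        (galoisCohomology.localization (ρ.tateDual n) (Sum.inl w) 1 y)
    | Sum.inr _ => 0
  have hsplit : ∀ v ∈ S, localTatePairingZMod ρ n v (inv v) (t v)
      (galoisCohomology.localization (ρ.tateDual n) v 1 y) =
      localTatePairingZMod ρ n v (inv v) (t₀ v) (galoisCohomology.localization (ρ.tateDual n) v 1 y) + h v := by
    intro v _
    cases v with
    | inl w => simp only [t, h, ht₀inl w, map_zero, AddMonoidHom.zero_apply, zero_add]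
    | inr v => simp only [t, h, add_zero]
  rw [Finset.sum_congr rfl hsplit, Finset.sum_add_distrib]
  congr 1
  have hsub : (Finset.univ : Finset (InfinitePlace K)).map ⟨Sum.inl, Sum.inl_injective⟩ ⊆ S := by
    intro v hv
    rw [Finset.mem_map] at hv
    obtain ⟨w, -, rfl⟩ := hv
    exact hS₁S (hS₀S₁ (hinf w))
  rw [← Finset.sum_subset hsub (fun v _ hv => ?_), Finset.sum_map]
  · rfl
  · cases v with
    | inl w => exact absurd (Finset.mem_map.2 ⟨w, Finset.mem_univ w, rfl⟩) hv
    | inr v => rfl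

/-- **The same from the named fact `poitouTate_selmerStructure_duality_real K`** (Milne I Cor. 2.3, Ex. 1.6 (c),
Thm. 2.6, Thm. 4.10 (b), Howard Thm. 2.1.11, for ONE family of local invariant maps): for every level `n ≥ 1` there is a
family `inv`, perfect at the finite places, injective at the real places, with the Poitou–Tate vanishing on global
classes, which represents EVERY functional on `H¹(K, M^D)` vanishing on `Ш¹(K, M^D)` by sums of local Tate pairings
against one family `t ∈ ∏_v H¹(K_v, M)` — for every finite `n`-torsion `M` over ANY number field `K` (real places
allowed; `K = ℚ`, `n = 2^k` is the case of crux K4).  CONDITIONAL on the named fact (hypothesis `h`); the remaining step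
to Milne I 4.10 (a) (`poitouTate_sha_tateDual K`) is the degree-`2` readout `Ш²(K, M) ≅ H¹(K, M^D)^* / γ¹(P¹(K, M))`
(`sha_tateDual_of_readout_real`). [cite: MilneADT2006, Ch. I, Thm. 4.10 (a)(b), Cor. 2.3, Thm. 2.6, Ex. 1.6 (c)] -/
theorem exists_localInvariants_sha_annihilator_of_poitouTate_real
    (h : poitouTate_selmerStructure_duality_real K) (n : ℕ) [NeZero n] :
    ∃ inv : LocalInvariants K n, inv.IsPerfect ∧ inv.InjectiveAtRealPlaces ∧ inv.SumLocalTermEqZero ∧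
      ∀ ⦃M : Type u⦄ [AddCommGroup M] [TopologicalSpace M] [DiscreteTopology M] [Finite M]
        (ρ : DiscreteGaloisModule K M), (∀ m : M, n • m = 0) →
        ∀ (S₀ : Finset (Place K)), (∀ w : InfinitePlace K, (Sum.inl w : Place K) ∈ S₀) →
        (∀ v : HeightOneSpectrum (𝓞 K), (Sum.inr v : Place K) ∉ S₀ →
          ((n : ℕ) : 𝓞 K) ∉ v.asIdeal ∧ GaloisRep.IsUnramifiedAt v ρ) →
        ∀ φ : galoisCohomology (ρ.tateDual n) 1 →+ ZMod n,
          (∀ y ∈ sha (ρ.tateDual n), φ y = 0) →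
          ∃ (S₁ : Finset (Place K)) (t : Π v : Place K, galoisCohomology (ρ.toLocal v) 1),
            S₀ ⊆ S₁ ∧
            (∀ v : HeightOneSpectrum (𝓞 K), (Sum.inr v : Place K) ∉ S₁ →
              t (Sum.inr v) ∈ unramifiedSubgroup (GaloisRep.toLocal v ρ) 1) ∧
            ∀ (y : galoisCohomology (ρ.tateDual n) 1) (S : Finset (Place K)), S₁ ⊆ S →
              (∀ v : HeightOneSpectrum (𝓞 K), (Sum.inr v : Place K) ∉ S →
                galoisCohomology.localization (ρ.tateDual n) (Sum.inr v) 1 y ∈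
                  unramifiedSubgroup (GaloisRep.toLocal v (ρ.tateDual n)) 1) →
              φ y = ∑ v ∈ S, localTatePairingZMod ρ n v (inv v) (t v)
                (galoisCohomology.localization (ρ.tateDual n) v 1 y) := by
  obtain ⟨inv, hperf, hvan, hur, hcomp, hreal⟩ := h n
  exact ⟨inv, hperf, hreal, hvan, fun M _ _ _ _ ρ hM S₀ hinf hS₀ φ hφ =>
    exists_family_sum_localTatePairing_eq_real hperf hreal hur hcomp ρ hM S₀ hinf hS₀ φ hφ⟩

end Main

/-! ## §3 The perfect pairing from a readout, archimedean components live -/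

section Perfect

/-- **`Ш²(K, M) × Ш¹(K, M^D) → ℤ/n` is perfect, from a readout of `Ш²` that is additive, injective and surjective modulo
sums of local pairings — ANY number field `K`** (Milne I Thm. 4.10 (a) for the module `M`; the real-place version of
`PoitouTateShaAnnihilator.sha_tateDual_of_readout`).  Hypotheses: `inv` with `IsPerfect`, `InjectiveAtRealPlaces`,
`UnramifiedOrthogonal`, `SelmerComplement`; `M` finite `n`-torsion unramified off the finite `S₀ ⊇ {v ∣ ∞} ∪ {v ∣ n}`;
`Ш¹(K, M^D)` finite; `e : Ш²(K, M) → Hom(H¹(K, M^D), ℤ/n)` with (add) `e(c + c') − e(c) − e(c')` a local sum on the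
classes unramified off some finite `S₁`; (inj) `e(c)` a local sum against a family unramified off some `S₁ ⊇ S₀`
(archimedean components ARBITRARY) ⟹ `c = 0`; (surj) every additive `φ` is `e(c) +` a local sum for some `c`.
CONCLUSION: `Ш²(K, M)` is finite and `b(c, y) = e(c)(y)` on `Ш²(K, M) × Ш¹(K, M^D)` has both adjoints bijective — the
existential conclusion of `poitouTate_sha_tateDual K` at `(n, M, ρ)`.
[cite: MilneADT2006, Ch. I, Thm. 4.10 (a) and proof, §0 Prop. 0.19, Thm. 2.13 (a)] [cite: Harari2020, Thm. 17.13 (b)] -/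
theorem sha_tateDual_of_readout_real
    {inv : LocalInvariants K n} (hperf : inv.IsPerfect) (hreal : inv.InjectiveAtRealPlaces)
    (hur : inv.UnramifiedOrthogonal) (hcomp : inv.SelmerComplement)
    (ρ : DiscreteGaloisModule K M) (hM : ∀ m : M, n • m = 0)
    (S₀ : Finset (Place K)) (hinf : ∀ w : InfinitePlace K, (Sum.inl w : Place K) ∈ S₀)
    (hS₀ : ∀ v : HeightOneSpectrum (𝓞 K), (Sum.inr v : Place K) ∉ S₀ →
      ((n : ℕ) : 𝓞 K) ∉ v.asIdeal ∧ GaloisRep.IsUnramifiedAt v ρ)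
    [Finite (sha (ρ.tateDual n))]
    (e : shaTwo ρ → (galoisCohomology (ρ.tateDual n) 1 →+ ZMod n))
    (hadd : ∀ c c' : shaTwo ρ, ∃ (S₁ : Finset (Place K)) (t : Π v : Place K, galoisCohomology (ρ.toLocal v) 1),
      ∀ (y : galoisCohomology (ρ.tateDual n) 1) (S : Finset (Place K)), S₁ ⊆ S →
        (∀ v : HeightOneSpectrum (𝓞 K), (Sum.inr v : Place K) ∉ S →
          galoisCohomology.localization (ρ.tateDual n) (Sum.inr v) 1 y ∈
            unramifiedSubgroup (GaloisRep.toLocal v (ρ.tateDual n)) 1) →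
        (e (c + c') - e c - e c') y = ∑ v ∈ S, localTatePairingZMod ρ n v (inv v) (t v)
          (galoisCohomology.localization (ρ.tateDual n) v 1 y))
    (hinj : ∀ c : shaTwo ρ, (∃ (S₁ : Finset (Place K)) (t : Π v : Place K, galoisCohomology (ρ.toLocal v) 1),
      S₀ ⊆ S₁ ∧
      (∀ v : HeightOneSpectrum (𝓞 K), (Sum.inr v : Place K) ∉ S₁ →
        t (Sum.inr v) ∈ unramifiedSubgroup (GaloisRep.toLocal v ρ) 1) ∧
      ∀ (y : galoisCohomology (ρ.tateDual n) 1) (S : Finset (Place K)), S₁ ⊆ S →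
        (∀ v : HeightOneSpectrum (𝓞 K), (Sum.inr v : Place K) ∉ S →
          galoisCohomology.localization (ρ.tateDual n) (Sum.inr v) 1 y ∈
            unramifiedSubgroup (GaloisRep.toLocal v (ρ.tateDual n)) 1) →
        e c y = ∑ v ∈ S, localTatePairingZMod ρ n v (inv v) (t v)
          (galoisCohomology.localization (ρ.tateDual n) v 1 y)) → c = 0)
    (hsurj : ∀ φ : galoisCohomology (ρ.tateDual n) 1 →+ ZMod n, ∃ (c : shaTwo ρ) (S₁ : Finset (Place K))
      (t : Π v : Place K, galoisCohomology (ρ.toLocal v) 1),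
      ∀ (y : galoisCohomology (ρ.tateDual n) 1) (S : Finset (Place K)), S₁ ⊆ S →
        (∀ v : HeightOneSpectrum (𝓞 K), (Sum.inr v : Place K) ∉ S →
          galoisCohomology.localization (ρ.tateDual n) (Sum.inr v) 1 y ∈
            unramifiedSubgroup (GaloisRep.toLocal v (ρ.tateDual n)) 1) →
        (φ - e c) y = ∑ v ∈ S, localTatePairingZMod ρ n v (inv v) (t v)
          (galoisCohomology.localization (ρ.tateDual n) v 1 y)) :
    Finite (shaTwo ρ) ∧ ∃ b : shaTwo ρ →+ sha (ρ.tateDual n) →+ ZMod n,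
      (∀ (c : shaTwo ρ) (y : sha (ρ.tateDual n)), b c y = e c y) ∧ Bijective b ∧ Bijective b.flip := by
  classical
  -- local sums vanish on `Ш¹(K, M^D)`
  have hsha_loc : ∀ y : sha (ρ.tateDual n), ∀ v : Place K,
      galoisCohomology.localization (ρ.tateDual n) v 1 (y : galoisCohomology (ρ.tateDual n) 1) = 0 :=
    fun y v => (DiscreteGaloisModule.mem_sha_iff _ _).1 y.2 v
  have hsha_ur : ∀ (y : sha (ρ.tateDual n)) (S : Finset (Place K)),
      ∀ v : HeightOneSpectrum (𝓞 K), (Sum.inr v : Place K) ∉ S →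
        galoisCohomology.localization (ρ.tateDual n) (Sum.inr v) 1 (y : galoisCohomology (ρ.tateDual n) 1) ∈
          unramifiedSubgroup (GaloisRep.toLocal v (ρ.tateDual n)) 1 :=
    fun y S v _ => by rw [hsha_loc y (Sum.inr v)]; exact AddSubgroup.zero_mem _
  have hlocal0 : ∀ (S : Finset (Place K)) (t : Π v : Place K, galoisCohomology (ρ.toLocal v) 1)
      (y : sha (ρ.tateDual n)),
      ∑ v ∈ S, localTatePairingZMod ρ n v (inv v) (t v)
        (galoisCohomology.localization (ρ.tateDual n) v 1 (y : galoisCohomology (ρ.tateDual n) 1)) = 0 :=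
    fun S t y => Finset.sum_eq_zero fun v _ => by rw [hsha_loc y v, map_zero]
  have hshaN : ∀ y : sha (ρ.tateDual n), n • y = 0 := fun y => Subtype.ext (by
    rw [AddSubgroup.coe_nsmul, AddSubgroup.coe_zero]
    exact galoisCohomology.nsmul_eq_zero_of_forall _
      (fun f => DiscreteGaloisModule.TateDual.nsmul_eq_zero f) _)
  -- the pairing `b(c, y) = e(c)(y)`
  have hR_add : ∀ c c' : shaTwo ρ, (e (c + c')).comp (sha (ρ.tateDual n)).subtype =
      (e c).comp (sha (ρ.tateDual n)).subtype + (e c').comp (sha (ρ.tateDual n)).subtype := by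
    intro c c'
    obtain ⟨S₁, t, h⟩ := hadd c c'
    ext y
    have hy := h (y : galoisCohomology (ρ.tateDual n) 1) S₁ le_rfl (hsha_ur y S₁)
    rw [hlocal0] at hy
    simp only [AddMonoidHom.sub_apply] at hy
    simp only [AddMonoidHom.comp_apply, AddSubgroup.coe_subtype, AddMonoidHom.add_apply]
    rw [sub_sub, sub_eq_zero] at hy
    rw [hy]
  let b : shaTwo ρ →+ (sha (ρ.tateDual n) →+ ZMod n) :=
    { toFun := fun c => (e c).comp (sha (ρ.tateDual n)).subtype
      map_zero' := by
        have h := hR_add 0 0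
        rw [add_zero] at h
        exact left_eq_add.1 h
      map_add' := hR_add }
  have hb : ∀ (c : shaTwo ρ) (y : sha (ρ.tateDual n)), b c y = e c y := fun _ _ => rfl
  -- injective: a readout vanishing on `Ш¹` is a local sum (§2, archimedean components live), hence `c = 0` by (inj)
  have hbinj : Injective b := by
    intro c c' hcc'
    rw [← sub_eq_zero]
    apply hinj
    have h0 : b (c - c') = 0 := by rw [map_sub, hcc', sub_self]
    have hφ : ∀ y ∈ sha (ρ.tateDual n), e (c - c') y = 0 := fun y hy => by
      have := DFunLike.congr_fun h0 ⟨y, hy⟩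
      rwa [hb] at this
    exact exists_family_sum_localTatePairing_eq_real hperf hreal hur hcomp ρ hM S₀ hinf hS₀ (e (c - c')) hφ
  -- surjective: extend a character of `Ш¹` to `H¹(K, M^D)` and read it
  have hbsurj : Surjective b := by
    intro χ
    obtain ⟨φ, hφ⟩ := exists_addMonoidHom_extend_of_nsmul_eq_zero
      (galoisCohomology.nsmul_eq_zero_of_forall _ (fun f => DiscreteGaloisModule.TateDual.nsmul_eq_zero f))
      (sha (ρ.tateDual n)) χ
    obtain ⟨c, S₁, t, h⟩ := hsurj φ
    refine ⟨c, ?_⟩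
    ext y
    have hy := h (y : galoisCohomology (ρ.tateDual n) 1) S₁ le_rfl (hsha_ur y S₁)
    rw [hlocal0, AddMonoidHom.sub_apply, sub_eq_zero] at hy
    rw [hb, ← hy, hφ]
  -- `Ш²` is `n`-torsion (it embeds in `Hom(Ш¹, ℤ/n)`) and finite
  have hshaTwoN : ∀ c : shaTwo ρ, n • c = 0 := fun c => hbinj (by
    rw [map_nsmul, map_zero]
    ext y
    rw [AddMonoidHom.nsmul_apply, AddMonoidHom.zero_apply, nsmul_eq_mul, ZMod.natCast_self, zero_mul])
  haveI : Finite (sha (ρ.tateDual n) →+ ZMod n) := finite_addMonoidHom_zmod _ n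
  haveI hfin : Finite (shaTwo ρ) := Finite.of_injective b hbinj
  -- the right adjoint is injective: characters of `Ш¹` separate points and `b` is onto them
  have hbflip : Injective b.flip := by
    intro y y' hyy'
    by_contra hne
    obtain ⟨χ, hχ⟩ := exists_addMonoidHom_zmod_apply_ne_zero hshaN (sub_ne_zero.2 hne)
    obtain ⟨c, rfl⟩ := hbsurj χ
    apply hχ
    have := DFunLike.congr_fun hyy' c
    rw [AddMonoidHom.flip_apply, AddMonoidHom.flip_apply] at this
    rw [map_sub, this, sub_self]
  exact ⟨hfin, b, hb, AddMonoidHom.bijective_of_injective_of_injective_flip hshaTwoN hshaN b hbinj hbflip⟩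

end Perfect

end Summit.BirchSwinnertonDyer.BirchSwinnertonDyer.Theorems.SignedEC.MuReal

end
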